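import Summits.QuantumFields.YangMills.Theorems.IR.BlockedActivityWRefineGen
import Summits.QuantumFields.YangMills.Theorems.IR.TypFormatBootstrap
import HarnessLib

/-!
# Crux `IR` (stmt-QuantumFields-19354), lane B: MESH COARSENING of the typical-class format Uc — cells, the coarse class, clauses (ii)∕(iii)

Helper module for item `stmt-QuantumFields-19354` (`--supports`; it closes nothing).  Companion of `Theorems/IR/TypFormatBootstrap.lean` (window
bootstrap at the SAME mesh).  Here the mesh grows: a mesh-`B` frame `w` (`B ≥ b`) is refined into the mesh-`b` frame `refineGen b w` of g6's
`Theorems/IR/BlockedActivityWRefineGen.lean`; a typical class `Typ` for the FINE frame induces the COARSE class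
`coarseTyp b w Typ d := {σ | σ ∈ Typ c for every fine cell c of d}` («every fine sub-cell typical»).

* §1 `fineCells b w d` (the fine cells of the coarse cell `d`, a box of `∏ pieceCount ≤ (2(B∕b)+1)⁴` fine indices), `mem_fineCells_iff`
  (`c ∈ fineCells d ↔ coarseIdx ∘ c = d`), `card_fineCells_le`, `cellEdges_eq_biUnion_fineCells`, `regionEdges_eq_fine`, geometry:
  `coarseIdx_adj` (fine neighbours lie in coarse neighbours), `cumPieces_add_ge` ∕ `coarseIdx_near` (a fine cell within index distance `m·(B∕b)` of a fine
  cell of `d` has coarse index within `m` of `d`).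
* §2 `coarseTyp`, `typLocal_coarseTyp`; ★ `clauseIIukp_coarseTyp` — fine clause (ii) at rarity `δ` ⇒ coarse clause (ii) at rarity `(2(B∕b)+1)⁴·δ` (union bound
  over the choice of one atypical fine sub-cell per charged coarse cell; fine neighbours of a chosen cell lie in coarse neighbours, resampled or coarse-typical);
  ★ `clauseIII_coarseTyp` — the same for the torus anchor (iii).
Clause (i) and the assembled `typShellCondUKPc_coarsen` are in `Theorems/IR/TypFormatCoarsen.lean`.

HONEST FRAMING: bookkeeping inside one FORMAT of one open gap-crux of a CONDITIONAL chain; nothing about mixing at any `β`, a gap or Clay.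
No `sorry`; axioms ⊆ {propext, Classical.choice, Quot.sound}; no instances, no notation.
-/

set_option autoImplicit false

noncomputable section

open MeasureTheory
open scoped ENNReal
open Literature.MathematicalPhysics
open Literature.MathematicalPhysics.QuantumFieldTheory Literature.MathematicalPhysics.QuantumLattice
open Literature.Probability.LatticeModels
open Summit.QuantumFields.YangMills.Cruxes.IR.Tempered (cellEdges windowCells regionEdges)
open Summit.QuantumFields.YangMills.Cruxes.IR.ShellTempered (windowCellsPlus)
open Summit.QuantumFields.YangMills.Cruxes.IR.CellTempered.Engine (frameIdx frameIdx_le lt_frameIdx_succ frameIdx_eq_iff frameCell frameCell_eq_iff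
  mem_cellEdges_frameCell regionEdges_union)
open Summit.QuantumFields.YangMills.Cruxes.IR.BlockedActivity (Cell pieceCount cumPieces coarseIdx refineGen cumPieces_succ cumPieces_step
  frame_le_of_le le_frameIdx_of_le frameIdx_lt_of_lt coarseIdx_cum isFrame_refineGen le_refineGen refineGen_succ_le cellEdges_refineGen_subset
  frameCell_eq_coarseIdx_refineGen regionEdges_union_refineGen pieceCount_le div_le_pieceCount frame_step)
open Summit.QuantumFields.YangMills.Cruxes.IR.OnsetFormatsUc (TypLocal ClauseIIukp ClauseIII)

namespace Summit.QuantumFields.YangMills.Cruxes.IR.OnsetFormatsUc.TypCoarsen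

/-! ## §1 Fine cells of a coarse cell; geometry -/

section Cells

variable {B b : ℕ} {w : Fin 4 → ℤ → ℤ}

/-- The fine cells (cells of `refineGen b w`) of the coarse cell `d` of `w`: the box `∏ᵢ [cumPieces (d i), cumPieces (d i + 1))`. -/
def fineCells (b : ℕ) (w : Fin 4 → ℤ → ℤ) (d : Cell) : Finset Cell :=
  Fintype.piFinset fun i : Fin 4 => Finset.Ico (cumPieces b w i (d i)) (cumPieces b w i (d i + 1))

variable (hb : 1 ≤ b) (hbB : b ≤ B) (hw : AfPincerUc.IsFrame B w)
include hb hbB hw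

/-- `c` is a fine cell of `d` iff its coarse indices are `d`. -/
theorem mem_fineCells_iff (d c : Cell) : c ∈ fineCells b w d ↔ (fun i => coarseIdx b w i (c i)) = d := by
  simp only [fineCells, Fintype.mem_piFinset, Finset.mem_Ico, funext_iff]
  refine forall_congr' fun i => ?_
  rw [coarseIdx, frameIdx_eq_iff (cumPieces_step hb hbB hw i)]

omit hbB in
/-- A coarse cell has at most `(2(B∕b)+1)⁴` fine cells. -/
theorem card_fineCells_le (d : Cell) : (fineCells b w d).card ≤ (2 * (B / b) + 1) ^ 4 := by
  rw [fineCells, Fintype.card_piFinset]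
  have h : ∀ i : Fin 4, (Finset.Ico (cumPieces b w i (d i)) (cumPieces b w i (d i + 1))).card ≤ 2 * (B / b) + 1 := fun i => by
    rw [Int.card_Ico, cumPieces_succ]
    have := pieceCount_le hb hw i (d i)
    omega
  calc ∏ i : Fin 4, (Finset.Ico (cumPieces b w i (d i)) (cumPieces b w i (d i + 1))).card ≤ ∏ _i : Fin 4, (2 * (B / b) + 1) :=
        Finset.prod_le_prod' fun i _ => h i
    _ = (2 * (B / b) + 1) ^ 4 := by rw [Finset.prod_const, Finset.card_univ, Fintype.card_fin]

/-- The fine cell of a link lies in `fineCells` of its coarse cell. -/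
theorem frameCell_mem_fineCells (v : QuantumLattice.ZdEdge 4) : frameCell (refineGen b w) v ∈ fineCells b w (frameCell w v) := by
  rw [mem_fineCells_iff hb hbB hw, frameCell_eq_coarseIdx_refineGen hb hbB hw v]

/-- **A coarse cell is the union of its fine cells.** -/
theorem cellEdges_eq_biUnion_fineCells (d : Cell) : cellEdges w d = (fineCells b w d).biUnion (cellEdges (refineGen b w)) := by
  ext v
  have hw1 := frame_step hw (hb.trans hbB)
  have hf1 := frame_step (isFrame_refineGen hb hbB hw) hb
  rw [Finset.mem_biUnion]
  constructor
  · intro hv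
    have hvd : frameCell w v = d := (frameCell_eq_iff hw1 v d).2 hv
    refine ⟨frameCell (refineGen b w) v, ?_, mem_cellEdges_frameCell hf1 v⟩
    have h := frameCell_mem_fineCells hb hbB hw v
    rwa [hvd] at h
  · rintro ⟨c, hc, hv⟩
    have hvc : frameCell (refineGen b w) v = c := (frameCell_eq_iff hf1 v c).2 hv
    have hcd : (fun i => coarseIdx b w i (c i)) = d := (mem_fineCells_iff hb hbB hw d c).1 hc
    refine (frameCell_eq_iff hw1 v d).1 ?_
    rw [frameCell_eq_coarseIdx_refineGen hb hbB hw v, hvc]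
    exact hcd

/-- **A coarse region is the fine region of the fine cells.** -/
theorem regionEdges_eq_fine (F : Finset Cell) : regionEdges w F = regionEdges (refineGen b w) (F.biUnion (fineCells b w)) := by
  classical
  simp only [Summit.QuantumFields.YangMills.Cruxes.IR.Tempered.regionEdges, Finset.biUnion_biUnion]
  congr 1
  funext d
  exact cellEdges_eq_biUnion_fineCells hb hbB hw d

/-- Fine neighbours lie in coarse neighbours: `|k − k'| ≤ 1 ⇒ |coarseIdx k − coarseIdx k'| ≤ 1`. -/
theorem coarseIdx_adj (i : Fin 4) {k k' : ℤ} (h : |k - k'| ≤ 1) : |coarseIdx b w i k - coarseIdx b w i k'| ≤ 1 := by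
  have hc := cumPieces_step hb hbB hw i
  have hk := abs_le.1 h
  -- monotone steps: `coarseIdx (t+1) ≤ coarseIdx t + 1` and `coarseIdx` is monotone
  have hmono : ∀ s t : ℤ, s ≤ t → coarseIdx b w i s ≤ coarseIdx b w i t := fun s t hst =>
    le_frameIdx_of_le hc ((frameIdx_le hc s).trans hst)
  have hstep : ∀ t : ℤ, coarseIdx b w i (t + 1) ≤ coarseIdx b w i t + 1 := fun t => by
    have h1 := lt_frameIdx_succ hc t
    have h2 := hc (frameIdx (cumPieces b w i) t + 1)
    have h3 : t + 1 < cumPieces b w i (frameIdx (cumPieces b w i) t + 1 + 1) := by linarith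
    have := frameIdx_lt_of_lt hc h3
    unfold coarseIdx; omega
  rw [abs_le]
  constructor
  · have h1 := hmono k' (k + 1) (by omega)
    have h2 := hstep k
    linarith
  · have h1 := hmono k (k' + 1) (by omega)
    have h2 := hstep k'
    linarith

omit hbB in
/-- `cumPieces (a + m) ≥ cumPieces a + m·(B∕b)` (every coarse interval has at least `B∕b` fine pieces). -/
theorem cumPieces_add_ge (i : Fin 4) (a : ℤ) (m : ℕ) : cumPieces b w i a + m * ((B / b : ℕ) : ℤ) ≤ cumPieces b w i (a + m) := by
  induction m with
  | zero => simp
  | succ m ih =>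
    have h := div_le_pieceCount hb hw i (a + m)
    have e : a + ((m + 1 : ℕ) : ℤ) = a + m + 1 := by push_cast; ring
    rw [e, cumPieces_succ, Nat.cast_succ]
    have e2 : ((m : ℤ) + 1) * ((B / b : ℕ) : ℤ) = (m : ℤ) * ((B / b : ℕ) : ℤ) + ((B / b : ℕ) : ℤ) := by ring
    rw [e2]
    linarith

/-- **Window geometry**: if `coarseIdx y = c` and `|k − y| ≤ m·(B∕b)` then `|coarseIdx k − c| ≤ m`. -/
theorem coarseIdx_near (i : Fin 4) {k y c : ℤ} (hy : coarseIdx b w i y = c) (m : ℕ) (hk : |k - y| ≤ m * ((B / b : ℕ) : ℤ)) :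
    |coarseIdx b w i k - c| ≤ m := by
  have hc := cumPieces_step hb hbB hw i
  have hyc := (frameIdx_eq_iff hc y c).1 hy
  have hk' := abs_le.1 hk
  rw [abs_le]
  constructor
  · -- `cum (c - m) + m·K ≤ cum c ≤ y`, so `cum (c - m) ≤ k`
    have h1 := cumPieces_add_ge hb hw i (c - m) m
    rw [sub_add_cancel] at h1
    have h2 : cumPieces b w i (c - m) ≤ k := by linarith
    have := le_frameIdx_of_le hc h2
    unfold coarseIdx; linarith
  · -- `k ≤ y + m·K < cum (c+1) + m·K ≤ cum (c + 1 + m)`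
    have h1 := cumPieces_add_ge hb hw i (c + 1) m
    have h2 : k < cumPieces b w i (c + 1 + m) := by linarith
    have := frameIdx_lt_of_lt hc h2
    unfold coarseIdx; linarith

/-- A fine cell of a coarse cell inside the torus box `[-S, S+1)` lies inside it. -/
theorem fine_mem_box {S : ℕ} {d c : Cell} (hc : c ∈ fineCells b w d) (hd : ∀ i, -(S : ℤ) ≤ w i (d i) ∧ w i (d i + 1) ≤ (S : ℤ) + 1)
    (i : Fin 4) : -(S : ℤ) ≤ refineGen b w i (c i) ∧ refineGen b w i (c i + 1) ≤ (S : ℤ) + 1 := by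
  have hcd : coarseIdx b w i (c i) = d i := congr_fun ((mem_fineCells_iff hb hbB hw d c).1 hc) i
  have h1 := le_refineGen hb hbB hw i (c i)
  have h2 := refineGen_succ_le hb hbB hw i (c i)
  rw [hcd] at h1 h2
  exact ⟨(hd i).1.trans h1, h2.trans (hd i).2⟩

end Cells

/-! ## §2 The coarse class and clauses (ii), (iii) -/

section CoarseTyp

variable {G : Type} [Group G] [TopologicalSpace G] [IsTopologicalGroup G] [CompactSpace G]
  [MeasurableSpace G] [BorelSpace G] {N : ℕ} (ρ : G →* Matrix (Fin N) (Fin N) ℂ)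
variable {B b : ℕ} {w : Fin 4 → ℤ → ℤ}

/-- The COARSE class induced by a class for the fine frame: `d` is typical iff every fine cell of `d` is typical. -/
def coarseTyp (b : ℕ) (w : Fin 4 → ℤ → ℤ) (Typ : Cell → Set (LGConfig 4 G)) : Cell → Set (LGConfig 4 G) :=
  fun d => {σ | ∀ c ∈ fineCells b w d, σ ∈ Typ c}

variable (hb : 1 ≤ b) (hbB : b ≤ B) (hw : AfPincerUc.IsFrame B w)
include hb hbB hw

omit [Group G] [TopologicalSpace G] [IsTopologicalGroup G] [CompactSpace G] [BorelSpace G] in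
/-- The coarse class is cell-local for the coarse frame. -/
theorem typLocal_coarseTyp {Typ : Cell → Set (LGConfig 4 G)} (hT : TypLocal (refineGen b w) Typ) : TypLocal w (coarseTyp b w Typ) := by
  refine ⟨fun d => ?_, fun d σ σ' h => ?_⟩
  · have : coarseTyp b w Typ d = ⋂ c ∈ fineCells b w d, Typ c := by
      ext σ; simp [coarseTyp, Set.mem_iInter]
    rw [this]
    exact MeasurableSet.biInter (Finset.countable_toSet _) fun c _ => hT.1 c
  · simp only [coarseTyp, Set.mem_setOf_eq]
    refine propext (forall_congr' fun c => forall_congr' fun hc => Iff.of_eq (hT.2 c fun e he => h e ?_))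
    rw [Finset.mem_coe, cellEdges_eq_biUnion_fineCells hb hbB hw d, Finset.mem_biUnion]
    exact ⟨c, hc, Finset.mem_coe.1 he⟩

omit [Group G] [TopologicalSpace G] [IsTopologicalGroup G] [CompactSpace G] [MeasurableSpace G] [BorelSpace G] hb hbB hw in
/-- Unfolding the coarse class: `σ ∉ coarseTyp d ↔ ∃` a fine cell of `d` at which `σ` is atypical. -/
theorem not_mem_coarseTyp_iff {Typ : Cell → Set (LGConfig 4 G)} (d : Cell) (σ : LGConfig 4 G) :
    σ ∉ coarseTyp b w Typ d ↔ ∃ c ∈ fineCells b w d, σ ∉ Typ c := by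
  simp [coarseTyp]

omit [Group G] [TopologicalSpace G] [IsTopologicalGroup G] [CompactSpace G] [MeasurableSpace G] [BorelSpace G] hbB in
/-- **The union bound behind clauses (ii)∕(iii).**  For a measure `μ` on any space and «bad» events `bad c`: if for every choice `φ` of one fine cell
per charged coarse cell `μ {∀ d, ω ∈ bad (φ d)} ≤ ofReal (δ^#F)` (`δ ≥ 0`), then `μ {∀ d ∈ F, ∃ fine c of d, ω ∈ bad c} ≤ ofReal (((2(B∕b)+1)⁴·δ)^#F)`
(at most `((2(B∕b)+1)⁴)^#F` choices, `card_fineCells_le`). -/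
theorem measure_forall_exists_bad_le {α : Type*} [MeasurableSpace α] (μ : Measure α) (bad : Cell → Set α) {δ : ℝ} (hδ : 0 ≤ δ)
    (F : Finset Cell)
    (hφ : ∀ φ : ↥F → Cell, (∀ d : ↥F, φ d ∈ fineCells b w d.1) → μ {ω | ∀ d : ↥F, ω ∈ bad (φ d)} ≤ ENNReal.ofReal (δ ^ F.card)) :
    μ {ω | ∀ d ∈ F, ∃ c ∈ fineCells b w d, ω ∈ bad c} ≤ ENNReal.ofReal (((((2 * (B / b) + 1) ^ 4 : ℕ) : ℝ) * δ) ^ F.card) := by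
  classical
  set Φ : Finset (↥F → Cell) := Fintype.piFinset fun d : ↥F => fineCells b w d.1 with hΦ
  have hsub : {ω : α | ∀ d ∈ F, ∃ c ∈ fineCells b w d, ω ∈ bad c} ⊆ ⋃ φ ∈ Φ, {ω | ∀ d : ↥F, ω ∈ bad (φ d)} := by
    intro ω hω
    simp only [Set.mem_setOf_eq] at hω
    choose φ hφm hφn using fun d : ↥F => hω d.1 d.2
    exact Set.mem_iUnion₂.2 ⟨φ, Fintype.mem_piFinset.2 fun d => hφm d, fun d => hφn d⟩
  have hcardΦ : Φ.card ≤ ((2 * (B / b) + 1) ^ 4) ^ F.card := by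
    rw [hΦ, Fintype.card_piFinset]
    calc ∏ d : ↥F, (fineCells b w d.1).card ≤ ∏ _d : ↥F, (2 * (B / b) + 1) ^ 4 :=
          Finset.prod_le_prod' fun d _ => card_fineCells_le hb hw d.1
      _ = ((2 * (B / b) + 1) ^ 4) ^ F.card := by rw [Finset.prod_const, Finset.card_univ, Fintype.card_coe]
  calc μ {ω | ∀ d ∈ F, ∃ c ∈ fineCells b w d, ω ∈ bad c} ≤ μ (⋃ φ ∈ Φ, {ω | ∀ d : ↥F, ω ∈ bad (φ d)}) := measure_mono hsub
    _ ≤ ∑ φ ∈ Φ, μ {ω | ∀ d : ↥F, ω ∈ bad (φ d)} := measure_biUnion_finset_le _ _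
    _ ≤ ∑ _φ ∈ Φ, ENNReal.ofReal (δ ^ F.card) := Finset.sum_le_sum fun φ hφΦ => hφ φ (Fintype.mem_piFinset.1 hφΦ)
    _ = (Φ.card : ℝ≥0∞) * ENNReal.ofReal (δ ^ F.card) := by rw [Finset.sum_const, nsmul_eq_mul]
    _ ≤ ENNReal.ofReal (((((2 * (B / b) + 1) ^ 4 : ℕ) : ℝ) * δ) ^ F.card) := by
        rw [← ENNReal.ofReal_natCast, ← ENNReal.ofReal_mul (Nat.cast_nonneg _), mul_pow]
        refine ENNReal.ofReal_le_ofReal (mul_le_mul_of_nonneg_right ?_ (pow_nonneg hδ _))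
        exact_mod_cast hcardΦ

omit [Group G] [TopologicalSpace G] [IsTopologicalGroup G] [CompactSpace G] [MeasurableSpace G] [BorelSpace G] in
/-- A choice `φ` of fine cells of the cells of `F` is injective (distinct coarse cells have disjoint fine cells): its image has `#F` elements and
`{∀ d, ω ∈ bad (φ d)} = {∀ c ∈ image φ, ω ∈ bad c}`. -/
theorem image_choice {α : Type*} (bad : Cell → Set α) (F : Finset Cell) (φ : ↥F → Cell) (hφ : ∀ d : ↥F, φ d ∈ fineCells b w d.1) :
    (Finset.univ.image φ).card = F.card ∧ {ω : α | ∀ d : ↥F, ω ∈ bad (φ d)} = {ω | ∀ c ∈ Finset.univ.image φ, ω ∈ bad c} := by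
  classical
  have hinj : Function.Injective φ := by
    intro d d' h
    have h1 := (mem_fineCells_iff hb hbB hw _ _).1 (hφ d)
    have h2 := (mem_fineCells_iff hb hbB hw _ _).1 (hφ d')
    rw [h] at h1
    exact Subtype.ext (h1.symm.trans h2)
  refine ⟨by rw [Finset.card_image_of_injective _ hinj, Finset.card_univ, Fintype.card_coe], ?_⟩
  ext ω
  simp only [Set.mem_setOf_eq, Finset.mem_image, Finset.mem_univ, true_and, forall_exists_index, forall_apply_eq_imp_iff]

omit [Group G] [TopologicalSpace G] [IsTopologicalGroup G] [CompactSpace G] [MeasurableSpace G] [BorelSpace G] in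
/-- The fine clause's neighbour condition for a choice of fine cells, from the coarse clause's neighbour condition (fine neighbours of a fine cell of `d` lie in
coarse neighbours of `d`, which are resampled — so their fine cells are — or coarse-typical — so the fine neighbour is typical). -/
theorem fine_neighbour_condition {Typ : Cell → Set (LGConfig 4 G)} {F F' : Finset Cell} (φ : ↥F → Cell)
    (hφ : ∀ d : ↥F, φ d ∈ fineCells b w d.1) {ζ : LGConfig 4 G}
    (hcond : ∀ d ∈ F, ∀ d' : Cell, (∀ i, |d' i - d i| ≤ 1) → d' ∈ F' ∨ ζ ∈ coarseTyp b w Typ d') :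
    ∀ c ∈ Finset.univ.image φ, ∀ c' : Cell, (∀ i, |c' i - c i| ≤ 1) → c' ∈ F'.biUnion (fineCells b w) ∨ ζ ∈ Typ c' := by
  classical
  intro c hc c' hc'
  obtain ⟨d, -, rfl⟩ := Finset.mem_image.1 hc
  have hφd := (mem_fineCells_iff hb hbB hw _ _).1 (hφ d)
  set d' : Cell := fun i => coarseIdx b w i (c' i) with hd'
  have hnear : ∀ i, |d' i - d.1 i| ≤ 1 := fun i => by
    have := coarseIdx_adj hb hbB hw i (hc' i)
    rw [congr_fun hφd i] at this
    exact this
  have hc'd' : c' ∈ fineCells b w d' := (mem_fineCells_iff hb hbB hw d' c').2 rfl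
  rcases hcond d.1 d.2 d' hnear with h | h
  · exact Or.inl (Finset.mem_biUnion.2 ⟨d', h, hc'd'⟩)
  · exact Or.inr (h c' hc'd')

/-- **Fine clause (ii) ⇒ coarse clause (ii)** at rarity `(2(B∕b)+1)⁴·δ` for the coarse class. -/
theorem clauseIIukp_coarseTyp {β δ : ℝ} (hδ : 0 ≤ δ) {Typ : Cell → Set (LGConfig 4 G)} (hII : ClauseIIukp ρ β (refineGen b w) δ Typ) :
    ClauseIIukp ρ β w ((((2 * (B / b) + 1) ^ 4 : ℕ) : ℝ) * δ) (coarseTyp b w Typ) := by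
  classical
  intro F F' hFF' hF ζ hcond
  rw [regionEdges_eq_fine hb hbB hw F']
  have e : {σ : LGConfig 4 G | ∀ d ∈ F, σ ∉ coarseTyp b w Typ d} = {σ | ∀ d ∈ F, ∃ c ∈ fineCells b w d, σ ∈ (Typ c)ᶜ} := by
    ext σ; simp only [Set.mem_setOf_eq, not_mem_coarseTyp_iff, Set.mem_compl_iff]
  rw [e]
  refine measure_forall_exists_bad_le hb hw _ (fun c => (Typ c)ᶜ) hδ F fun φ hφ => ?_
  obtain ⟨hcard, hev⟩ := image_choice hb hbB hw (fun c => (Typ c)ᶜ) F φ hφ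
  rw [hev, ← hcard]
  obtain ⟨d₀, hd₀⟩ := hF
  have h := hII (Finset.univ.image φ) (F'.biUnion (fineCells b w)) ?_ ⟨φ ⟨d₀, hd₀⟩, Finset.mem_image_of_mem _ (Finset.mem_univ _)⟩ ζ
    (fine_neighbour_condition hb hbB hw φ hφ hcond)
  · simpa only [Set.mem_compl_iff] using h
  · intro c hc
    obtain ⟨d, -, rfl⟩ := Finset.mem_image.1 hc
    exact Finset.mem_biUnion.2 ⟨d.1, hFF' d.2, hφ d⟩

/-- **Fine clause (iii) ⇒ coarse clause (iii)** at rarity `(2(B∕b)+1)⁴·δ` for the coarse class (mesh `B`: `4B ≤ 2S+1 ⇒ 4b ≤ 2S+1`; fine cells of a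
coarse cell inside the torus box lie inside it, `fine_mem_box`). -/
theorem clauseIII_coarseTyp {β δ : ℝ} (hδ : 0 ≤ δ) {Typ : Cell → Set (LGConfig 4 G)} (hIII : ClauseIII ρ β (refineGen b w) b δ Typ) :
    ClauseIII ρ β w B ((((2 * (B / b) + 1) ^ 4 : ℕ) : ℝ) * δ) (coarseTyp b w Typ) := by
  classical
  intro S hS F hF hin
  have hS' : 4 * b ≤ 2 * S + 1 := le_trans (Nat.mul_le_mul_left 4 hbB) hS
  have e : {V : GaugeConfig 4 (2 * S + 1) G | ∀ d ∈ F, torusLift (2 * S + 1) V ∉ coarseTyp b w Typ d} =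
      {V | ∀ d ∈ F, ∃ c ∈ fineCells b w d, V ∈ {V' : GaugeConfig 4 (2 * S + 1) G | torusLift (2 * S + 1) V' ∉ Typ c}} := by
    ext V; simp only [Set.mem_setOf_eq, not_mem_coarseTyp_iff]
  rw [e]
  refine measure_forall_exists_bad_le hb hw _ (fun c => {V' : GaugeConfig 4 (2 * S + 1) G | torusLift (2 * S + 1) V' ∉ Typ c}) hδ F
    fun φ hφ => ?_
  obtain ⟨hcard, hev⟩ := image_choice hb hbB hw (fun c => {V' : GaugeConfig 4 (2 * S + 1) G | torusLift (2 * S + 1) V' ∉ Typ c}) F φ hφ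
  rw [hev, ← hcard]
  obtain ⟨d₀, hd₀⟩ := hF
  have h := hIII S hS' (Finset.univ.image φ) ⟨φ ⟨d₀, hd₀⟩, Finset.mem_image_of_mem _ (Finset.mem_univ _)⟩ ?_
  · simpa only [Set.mem_setOf_eq] using h
  · intro c hc i
    obtain ⟨d, -, rfl⟩ := Finset.mem_image.1 hc
    exact fine_mem_box hb hbB hw (hφ d) (hin d.1 d.2) i

end CoarseTyp

end Summit.QuantumFields.YangMills.Cruxes.IR.OnsetFormatsUc.TypCoarsen

end
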